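import Summits.QuantumFields.YangMills.Theorems.BalabanUVNodesK2RunRemAtOfChain190

/-!
# Crux K2⁷ `EndpointGivenBR13SepCoPH` (stmt-QuantumFields-20543) — PRINT's ROAD IN ONE TEXT: the (190)-chain along the in-window runs RELATIVE TO ITS OWN ONE-LOOP
# NUMBERS `b`, the drift (D1) OF THOSE NUMBERS, survivor continuity ⟹ the crux decl BY NAME — no named jets, no κ, no anchor, no `θ.cβ`, no `θ.γ` (hypothesis form; 0 `def`)

Cell pub-balaban (b2b), seat `b2b-balaban-beta-an4` (BINDER row D4 OWNER), gen 152; sequel to `BalabanUVNodesK2RunRemAtOfChain190` (p603015).  Helper for crux K2⁷ =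
stmt-QuantumFields-20543 (`--supports … --as helper`); count-neutral; NO skeleton is registered by this file.

THE POINT (a located reading, kernel-checked).  DEF-1's run-wise END `endpointExistence_of_runRemAt_drift` (p596574 :213) DISCARDS two conjuncts of the letter `RunRemAt F κ θ hP c`:
the per-scale ANCHOR and the window bound `γ₀ ≤ θ.γ` — the END reads only `0 < γ₀`, the cap `r ≤ s`, `RunConstRemainder β b r γ₀`, `SurvCont β γ₀` and a drift
`OneLoopDrift s A b` of the SAME reference sequence `b` (`endpointExistence_of_drift_runConstRemainder_survCont`, p596574 :156).  On print's road the remainder is relative to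
the chain's OWN one-loop numbers ([I] (2.12)–(2.14): `β = β⁰ + β¹` with ONE `β⁰`), so K2⁷ follows from ONE text per tuple: SOME sequence `b` such that (i) the (190)-leaves hold at
every in-window run prefix for the remainder `β_{k+1}(prefix) − b_k` (rows (D4) ∧ B4 of record = NODE O), (ii) `b` drifts with some slope `s ≥ ε₁·K_rem,L` (row (D1) AT THE CHAIN's
OWN NUMBERS, with the cap), (iii) (C) on the survivor sets.  The anchor ∕ the named jets ∕ κ ∕ the chart scale `θ.cβ` enter v6's registered pair {1ᴬ, 2ᴮ″} ONLY to split this one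
obligation between two desks along the identity of `b` (CRIT-2 ROUND 4 (2): «one ∃-statement split along a seam neither owner can see») — they are NOT load-bearing for END.

WHAT IS HERE (all hypotheses displayed; texts INLINE, no `def`).
* §1 `endpointExistence_of_runLeaves190H_ownDrift` — at the Stage-13 record: run-wise (190)-socket relative to `b` + side conditions + `0 < γ₀` + `OneLoopDrift s A b` + cap
  `ε₁·K_rem,L ≤ s` + `SurvCont` ⟹ `EndpointExistence D.C.toB12` (p603015's `runConstRemainder_of_runLeaves190H` fed to DEF-1's run END with the datum's forward generation `D.fwd`).
  Box edition `endpointExistence_of_chainTFac190H_ownDrift` = the gaps cell's `endpointExistence_of_drift_chainTFac190H_cpt` at the record BY NAME ((C) from (C-pt)).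
* §2 `EndpointGivenBR13SepCoPH_of_ownDriftRunChain190K` — the ∀θ text at v6's full-prefix keying (unity ∧ slots → admissible → (B) → window → ∃ b s A M μ ν c ℓ α₂ q γ₀, …)
  ⟹ `…Theses.BalabanUVNodes.EndpointGivenBR13SepCoPH` BY NAME.  (B) ∕ window ∕ unity ∕ admissibility UNUSED (consistent with idea-4 F3).
* §3 `ownDriftRunChain190K_of_d1AnchoredK_runChain190K` — v6's pair road (iii) (p603015 §5's print-road text WITH named jets + v6's 1ᴬ) ⟹ the one text of §2 (take
  `b := θ.cβ • beta0OfJs F κ`, `s := θ.cβ·stepBal 2 F.L`; `oneLoopDrift_const_mul` BY NAME): the split pair is a SPECIAL CASE of the one text, never the other way.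

HONEST FRAMING.  Implications between displayed HYPOTHESIS SHAPES and elementary bookkeeping; NOTHING of Bałaban's analysis is asserted or discharged: the leaves at the record's
run histories (NODE O), the drift of the chain's own numbers (row (D1) at those numbers), the numerics with the cap and survivor continuity are hypotheses inhabited at no θ
here (instance 0∕1); (D4) NOT discharged; K2⁷ ∕ its two registered stubs NOT proved (v6: 2 registered, 0 closed); counts unmoved; [Balaban1987RG1] Thm 2 + (0.31) p. 259 is
UNPROVED IN PRINT; route R4 closes the CONDITIONAL finite-𝕋⁴ rung `BalabanLadder.UV` only — NOT the continuum limit, NOT ℝ⁴, NOT OS, NOT the Yang–Mills mass gap, NOT Clay.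
No `def`, no `instance`, no `notation`, no `axiom`.  Sources (context only; nothing printed is used as a hypothesis): [I] = [Balaban1987RG1] CMP **109** (1987): Thm 2 p. 259
(first sentence), Thm 3 p. 264, (1.20)–(1.22) p. 264, (2.12)–(2.14) p. 268, (5.10) p. 293; [II] = [Balaban1988RG2Cluster] CMP **116** (1988): Lemma 3 (2.38) p. 20.
-/

noncomputable section

namespace Summit.QuantumFields.YangMills.Theorems.BalabanUVNodesK2EndOfChain190OwnDrift

open Literature.MathematicalPhysics.QuantumFieldTheory.Balaban1983to89
open Literature.MathematicalPhysics.QuantumFieldTheory.Balaban1983to89.FlowStep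
open Literature.MathematicalPhysics.QuantumFieldTheory.Balaban1983to89.B12Beta (HistBox OneLoopSplit)
open Literature.MathematicalPhysics.QuantumFieldTheory.Balaban1983to89.B13ScaleTransfer (Pt)
open Literature.MathematicalPhysics.QuantumFieldTheory.Balaban1983to89.DagBinding (EndpointExistence)
open Literature.MathematicalPhysics.QuantumFieldTheory.Balaban1983to89.T4Continuum (T4Family)
open Literature.MathematicalPhysics.QuantumFieldTheory.Balaban1983to89.Beta.Drift (OneLoopDrift)
open Literature.MathematicalPhysics.QuantumFieldTheory.Balaban1983to89.Beta.RemainderChainLattice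
open Literature.MathematicalPhysics.QuantumFieldTheory.Balaban1983to89.Beta.RemainderLimitTorus (LDom limKernel)
open Literature.MathematicalPhysics.QuantumFieldTheory.Balaban1983to89.Beta.RemainderLocalityHolo
open Literature.MathematicalPhysics.QuantumFieldTheory.Balaban1983to89.Beta.RemainderDecay190
open Literature.MathematicalPhysics.QuantumFieldTheory.Balaban1983to89.Beta.RemainderDecay190HoloChain
open Summit.QuantumFields.BalabanUV.Gaps.BetaContFromD4Chain (CPt endpointExistence_of_drift_chainTFac190H_cpt)
open Summit.QuantumFields.YangMills.Theorems.BalabanUVNodesK2JsOfRecord (StepColourData beta0OfJs)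
open Summit.QuantumFields.YangMills.Theorems.BalabanUVNodesK2NamedJetsRemAt (ScaleAnchor)
open Summit.QuantumFields.YangMills.Theorems.BalabanUVNodesK2NamedJetsRunRemAt (SurvCont endpointExistence_of_drift_runConstRemainder_survCont)
open Summit.QuantumFields.YangMills.Theorems.BalabanUVNodesK2RunRemAtOfChain190 (runConstRemainder_of_runLeaves190H)
open Summit.QuantumFields.YangMills.Theorems.EndpointGivenBR13SepCoPH.Negative.RemNamedJets13FalseOfTwoNormalisations (oneLoopDrift_const_mul)

/-! ## §1 At the Stage-13 record: print's road relative to its own numbers ⟹ endpoint existence -/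

section Record

variable (F : T4Family) (θ : Node00.Stage13HParams F 2) (hP : θ.Provisos₁₃SepCoPH F 2)
variable {M : ℕ} [NeZero M] {μ ν : Fin 4} {c : B13.Consts} {ℓ α₂ : ℝ} {q : Consts190} {γ₀ s A : ℝ} {b : ℕ → ℝ}

/-- **★★ PRINT's ROAD, RUN EDITION, RELATIVE TO ITS OWN NUMBERS ⟹ `EndpointExistence`** at the Stage-13 datum: the (190)-leaves at every in-window run prefix for the remainder
`β_{k+1}(prefix) − b_k` (rows (D4) ∧ B4 = NODE O), the side conditions, `0 < γ₀`, a drift `OneLoopDrift s A b` of the SAME `b` (row (D1) at the chain's own numbers), the cap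
`ε₁·K_rem,L ≤ s` and (C) on the survivor sets — all hypotheses — give [I] Thm 2's endpoint-existence half for the datum's construction (DEF-1's
`endpointExistence_of_drift_runConstRemainder_survCont` BY NAME with the datum's forward generation `fwd`).  No anchor, no named jets, no κ, no `θ.cβ`, no `θ.γ`.
[cite: Balaban1987RG1, Thm 2 p.259 (first sentence), Thm 3 p.264, (1.20)-(1.22) p.264, (2.12)-(2.14) p.268 and (5.10) p.293; Balaban1988RG2Cluster, Lemma 3 (2.38) p.20] -/
theorem endpointExistence_of_runLeaves190H_ownDrift
    (hrun : ∀ (n : ℕ) (gs : ℕ → ℝ), RGEqH n (Node00.datumOfRecord₁₃SepCoPH F 2 θ hP).βfun gs → Step.InInterval γ₀ n gs → ∀ k, k ≤ n →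
      ∃ a : LDom 4 → Pt 4 → ℝ, (Node00.datumOfRecord₁₃SepCoPH F 2 θ hP).βfun k (prefixOf gs k) - b k =
        B12Beta.secondMoment (fun _ _ => limKernel a) μ ν ∧ Nonempty (PolLeavesTFac190H 4 M a c ℓ α₂ q))
    (hC : CondsL 4 c ℓ) (h22 : c.R22gen ℓ) (hq : q.Valid c.δ₀) (hs : SignsL c α₂ q.B₃) (hγ₀ : 0 < γ₀)
    (hdrift : OneLoopDrift s A b) (hcap : c.ε₁ * remCoeffL 4 M c α₂ q.B₃ ≤ s)
    (hcont : SurvCont (Node00.datumOfRecord₁₃SepCoPH F 2 θ hP).βfun γ₀) :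
    EndpointExistence (Node00.datumOfRecord₁₃SepCoPH F 2 θ hP).C.toB12 :=
  endpointExistence_of_drift_runConstRemainder_survCont (Node00.datumOfRecord₁₃SepCoPH F 2 θ hP).fwd hγ₀ hdrift
    (runConstRemainder_of_runLeaves190H hrun hC h22 hq hs (by norm_num)) hcap hcont

/-- **★ BOX EDITION at the record (the row's socket of record)**: ONE `ChainTFac190H` inhabitant for ANY split `Sβ` of the datum's β, (C-pt), the side conditions, `0 < γ₀`,
a drift of THE SPLIT's OWN numbers `Sβ.β0` and the cap ⟹ `EndpointExistence` — the gaps cell's generic `endpointExistence_of_drift_chainTFac190H_cpt` BY NAME at `d = 4` with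
the datum's `fwd` ((UP) and (C) DERIVED there).  = v1∕v2's LINE 1 composition, anchor-free and jets-free by construction. [cite: Balaban1987RG1, Thm 2 p.259 (first sentence), (1.22) p.264 and (4.4) p.281; Balaban1988RG2Cluster, Lemma 3 (2.38) p.20] -/
theorem endpointExistence_of_chainTFac190H_ownDrift (Sβ : OneLoopSplit (Node00.datumOfRecord₁₃SepCoPH F 2 θ hP).βfun)
    (R : ChainTFac190H 4 M μ ν Sβ γ₀ c ℓ α₂ q) (hcpt : CPt R) (hC : CondsL 4 c ℓ) (h22 : c.R22gen ℓ) (hq : q.Valid c.δ₀)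
    (hs : SignsL c α₂ q.B₃) (hγ₀ : 0 < γ₀) (hdrift : OneLoopDrift s A Sβ.β0) (hcap : c.ε₁ * remCoeffL 4 M c α₂ q.B₃ ≤ s) :
    EndpointExistence (Node00.datumOfRecord₁₃SepCoPH F 2 θ hP).C.toB12 :=
  endpointExistence_of_drift_chainTFac190H_cpt (Node00.datumOfRecord₁₃SepCoPH F 2 θ hP).fwd R hC h22 hq hs (by norm_num) hγ₀ hdrift hcap hcpt

end Record

/-! ## §2 ONE ∀θ text at v6's keying ⟹ the crux decl BY NAME -/

section Keyed

/-- **★★★ PRINT's ROAD IN ONE TEXT ⟹ THE CRUX DECL BY NAME.**  At every tuple carrying the crux's hypotheses: SOME reference sequence `b` (the chain's own one-loop numbers), SOME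
slope `s` and drift constant `A`, SOME chain data `(M, μ, ν, c, ℓ, α₂, q, γ₀)` with the (190)-leaves at every in-window run prefix relative to `b`, the side conditions,
`0 < γ₀`, the cap `ε₁·K_rem,L ≤ s`, the drift `OneLoopDrift s A b` and `SurvCont` ⟹ `EndpointGivenBR13SepCoPH`.  ONE obligation per tuple (NODE O + row (D1) at NODE O's own
numbers + numerics + (C) on survivors); v6's registered pair {1ᴬ, 2ᴮ″} on road (iii) is its special case `b := θ.cβ • beta0OfJs F κ` (§3).  (B) ∕ window ∕ unity ∕
admissibility UNUSED.  CONDITIONAL; K2⁷ NOT closed; instance 0∕1. [cite: Balaban1987RG1, Thm 2 p.259 (first sentence), Thm 3 p.264, (2.12)-(2.14) p.268 and (5.10) p.293; Balaban1988RG2Cluster, Lemma 3 (2.38) p.20] -/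
theorem EndpointGivenBR13SepCoPH_of_ownDriftRunChain190K
    (h : ∀ (F : T4Family) (θ : Node00.Stage13HParams F 2) (hP : θ.Provisos₁₃SepCoPH F 2),
      (θ.ZhUnity F 2 ∧ θ.SlotsNondegenerate₁₃ F 2) → θ.Admissible F 2 →
      B16.EndStatementBPrinted (Node00.datumOfRecord₁₃SepCoPH F 2 θ hP).C →
      (∃ γ₁ : ℝ, 0 < γ₁ ∧ ∀ γ : ℝ, 0 < γ → γ ≤ γ₁ →
        ∃ P : B12.RunParams, 1 ≤ P.K ∧ ((Node00.datumOfRecord₁₃SepCoPH F 2 θ hP).C P).flow.InInterval γ P.K) →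
      ∃ (b : ℕ → ℝ) (s A : ℝ) (M : ℕ) (_ : NeZero M) (μ ν : Fin 4) (c : B13.Consts) (ℓ α₂ : ℝ) (q : Consts190) (γ₀ : ℝ),
        (∀ (n : ℕ) (gs : ℕ → ℝ), RGEqH n (Node00.datumOfRecord₁₃SepCoPH F 2 θ hP).βfun gs → Step.InInterval γ₀ n gs → ∀ k, k ≤ n →
          ∃ a : LDom 4 → Pt 4 → ℝ, (Node00.datumOfRecord₁₃SepCoPH F 2 θ hP).βfun k (prefixOf gs k) - b k =
            B12Beta.secondMoment (fun _ _ => limKernel a) μ ν ∧ Nonempty (PolLeavesTFac190H 4 M a c ℓ α₂ q)) ∧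
        CondsL 4 c ℓ ∧ c.R22gen ℓ ∧ q.Valid c.δ₀ ∧ SignsL c α₂ q.B₃ ∧ 0 < γ₀ ∧
        c.ε₁ * remCoeffL 4 M c α₂ q.B₃ ≤ s ∧ OneLoopDrift s A b ∧
        SurvCont (Node00.datumOfRecord₁₃SepCoPH F 2 θ hP).βfun γ₀) :
    Summit.QuantumFields.YangMills.Theses.BalabanUVNodes.EndpointGivenBR13SepCoPH := by
  intro F θ hP hU hθ hB hwin
  obtain ⟨b, s, A, M, instM, μ, ν, c, ℓ, α₂, q, γ₀, hrun, hC, h22, hq, hs, hγ₀, hcap, hdrift, hcont⟩ := h F θ hP hU hθ hB hwin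
  exact endpointExistence_of_runLeaves190H_ownDrift F θ hP hrun hC h22 hq hs hγ₀ hdrift hcap hcont

end Keyed

/-! ## §3 v6's pair on road (iii) is the special case `b := θ.cβ • beta0OfJs F κ` of the one text -/

section PairIsSpecialCase

/-- **THE SPLIT PAIR ⟹ THE ONE TEXT** (never the converse): p603015 §5's print-road text WITH the named jets (its anchor conjunct feeding v6's 1ᴬ `D1AtAnchoredJets` for the bare
drift, rescaled by `θ.cβ` with `oneLoopDrift_const_mul`) yields §2's text at `b := θ.cβ • beta0OfJs F κ`, `s := θ.cβ·stepBal 2 F.L`; the anchor and `γ₀ ≤ θ.γ` are then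
simply dropped.  CONDITIONAL bookkeeping. [cite: Balaban1987RG1, (1.3) p.260, (2.12)-(2.14) p.268 and (5.10) p.293] -/
theorem ownDriftRunChain190K_of_d1AnchoredK_runChain190K
    (hD1 : ∀ (F : T4Family) (κ : StepColourData) (θ : Node00.Stage13HParams F 2) (hP : θ.Provisos₁₃SepCoPH F 2),
      (θ.ZhUnity F 2 ∧ θ.SlotsNondegenerate₁₃ F 2) → θ.Admissible F 2 →
      B16.EndStatementBPrinted (Node00.datumOfRecord₁₃SepCoPH F 2 θ hP).C →
      (∃ γ₁ : ℝ, 0 < γ₁ ∧ ∀ γ : ℝ, 0 < γ → γ ≤ γ₁ →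
        ∃ P : B12.RunParams, 1 ≤ P.K ∧ ((Node00.datumOfRecord₁₃SepCoPH F 2 θ hP).C P).flow.InInterval γ P.K) →
      ScaleAnchor (Node00.datumOfRecord₁₃SepCoPH F 2 θ hP).βfun (fun k => θ.cβ * beta0OfJs F κ k) →
      ∃ A : ℝ, OneLoopDrift (B12Normalization.stepBal 2 F.L) A (beta0OfJs F κ))
    (h : ∀ (F : T4Family) (θ : Node00.Stage13HParams F 2) (hP : θ.Provisos₁₃SepCoPH F 2),
      (θ.ZhUnity F 2 ∧ θ.SlotsNondegenerate₁₃ F 2) → θ.Admissible F 2 →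
      B16.EndStatementBPrinted (Node00.datumOfRecord₁₃SepCoPH F 2 θ hP).C →
      (∃ γ₁ : ℝ, 0 < γ₁ ∧ ∀ γ : ℝ, 0 < γ → γ ≤ γ₁ →
        ∃ P : B12.RunParams, 1 ≤ P.K ∧ ((Node00.datumOfRecord₁₃SepCoPH F 2 θ hP).C P).flow.InInterval γ P.K) →
      ∃ (κ : StepColourData) (M : ℕ) (_ : NeZero M) (μ ν : Fin 4) (c : B13.Consts) (ℓ α₂ : ℝ) (q : Consts190) (γ₀ : ℝ),
        (∀ (n : ℕ) (gs : ℕ → ℝ), RGEqH n (Node00.datumOfRecord₁₃SepCoPH F 2 θ hP).βfun gs → Step.InInterval γ₀ n gs → ∀ k, k ≤ n →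
          ∃ a : LDom 4 → Pt 4 → ℝ, (Node00.datumOfRecord₁₃SepCoPH F 2 θ hP).βfun k (prefixOf gs k) - θ.cβ * beta0OfJs F κ k =
            B12Beta.secondMoment (fun _ _ => limKernel a) μ ν ∧ Nonempty (PolLeavesTFac190H 4 M a c ℓ α₂ q)) ∧
        CondsL 4 c ℓ ∧ c.R22gen ℓ ∧ q.Valid c.δ₀ ∧ SignsL c α₂ q.B₃ ∧ 0 < γ₀ ∧ γ₀ ≤ θ.γ ∧
        c.ε₁ * remCoeffL 4 M c α₂ q.B₃ ≤ θ.cβ * B12Normalization.stepBal 2 F.L ∧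
        ScaleAnchor (Node00.datumOfRecord₁₃SepCoPH F 2 θ hP).βfun (fun k => θ.cβ * beta0OfJs F κ k) ∧
        SurvCont (Node00.datumOfRecord₁₃SepCoPH F 2 θ hP).βfun γ₀) :
    ∀ (F : T4Family) (θ : Node00.Stage13HParams F 2) (hP : θ.Provisos₁₃SepCoPH F 2),
      (θ.ZhUnity F 2 ∧ θ.SlotsNondegenerate₁₃ F 2) → θ.Admissible F 2 →
      B16.EndStatementBPrinted (Node00.datumOfRecord₁₃SepCoPH F 2 θ hP).C →
      (∃ γ₁ : ℝ, 0 < γ₁ ∧ ∀ γ : ℝ, 0 < γ → γ ≤ γ₁ →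
        ∃ P : B12.RunParams, 1 ≤ P.K ∧ ((Node00.datumOfRecord₁₃SepCoPH F 2 θ hP).C P).flow.InInterval γ P.K) →
      ∃ (b : ℕ → ℝ) (s A : ℝ) (M : ℕ) (_ : NeZero M) (μ ν : Fin 4) (c : B13.Consts) (ℓ α₂ : ℝ) (q : Consts190) (γ₀ : ℝ),
        (∀ (n : ℕ) (gs : ℕ → ℝ), RGEqH n (Node00.datumOfRecord₁₃SepCoPH F 2 θ hP).βfun gs → Step.InInterval γ₀ n gs → ∀ k, k ≤ n →
          ∃ a : LDom 4 → Pt 4 → ℝ, (Node00.datumOfRecord₁₃SepCoPH F 2 θ hP).βfun k (prefixOf gs k) - b k =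
            B12Beta.secondMoment (fun _ _ => limKernel a) μ ν ∧ Nonempty (PolLeavesTFac190H 4 M a c ℓ α₂ q)) ∧
        CondsL 4 c ℓ ∧ c.R22gen ℓ ∧ q.Valid c.δ₀ ∧ SignsL c α₂ q.B₃ ∧ 0 < γ₀ ∧
        c.ε₁ * remCoeffL 4 M c α₂ q.B₃ ≤ s ∧ OneLoopDrift s A b ∧
        SurvCont (Node00.datumOfRecord₁₃SepCoPH F 2 θ hP).βfun γ₀ := by
  intro F θ hP hU hθ hB hwin
  obtain ⟨κ, M, instM, μ, ν, c, ℓ, α₂, q, γ₀, hrun, hC, h22, hq, hs, hγ₀, -, hcap, hA, hcont⟩ := h F θ hP hU hθ hB hwin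
  obtain ⟨A, hdrift⟩ := hD1 F κ θ hP hU hθ hB hwin hA
  exact ⟨fun k => θ.cβ * beta0OfJs F κ k, θ.cβ * B12Normalization.stepBal 2 F.L, |θ.cβ| * A, M, instM, μ, ν, c, ℓ, α₂, q, γ₀,
    hrun, hC, h22, hq, hs, hγ₀, hcap, oneLoopDrift_const_mul hdrift θ.cβ, hcont⟩

/-- … so the one-text concluder reproduces p603015's pair concluder (consistency `example`, no new declaration). -/
example
    (hD1 : ∀ (F : T4Family) (κ : StepColourData) (θ : Node00.Stage13HParams F 2) (hP : θ.Provisos₁₃SepCoPH F 2),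
      (θ.ZhUnity F 2 ∧ θ.SlotsNondegenerate₁₃ F 2) → θ.Admissible F 2 →
      B16.EndStatementBPrinted (Node00.datumOfRecord₁₃SepCoPH F 2 θ hP).C →
      (∃ γ₁ : ℝ, 0 < γ₁ ∧ ∀ γ : ℝ, 0 < γ → γ ≤ γ₁ →
        ∃ P : B12.RunParams, 1 ≤ P.K ∧ ((Node00.datumOfRecord₁₃SepCoPH F 2 θ hP).C P).flow.InInterval γ P.K) →
      ScaleAnchor (Node00.datumOfRecord₁₃SepCoPH F 2 θ hP).βfun (fun k => θ.cβ * beta0OfJs F κ k) →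
      ∃ A : ℝ, OneLoopDrift (B12Normalization.stepBal 2 F.L) A (beta0OfJs F κ))
    (h : ∀ (F : T4Family) (θ : Node00.Stage13HParams F 2) (hP : θ.Provisos₁₃SepCoPH F 2),
      (θ.ZhUnity F 2 ∧ θ.SlotsNondegenerate₁₃ F 2) → θ.Admissible F 2 →
      B16.EndStatementBPrinted (Node00.datumOfRecord₁₃SepCoPH F 2 θ hP).C →
      (∃ γ₁ : ℝ, 0 < γ₁ ∧ ∀ γ : ℝ, 0 < γ → γ ≤ γ₁ →
        ∃ P : B12.RunParams, 1 ≤ P.K ∧ ((Node00.datumOfRecord₁₃SepCoPH F 2 θ hP).C P).flow.InInterval γ P.K) →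
      ∃ (κ : StepColourData) (M : ℕ) (_ : NeZero M) (μ ν : Fin 4) (c : B13.Consts) (ℓ α₂ : ℝ) (q : Consts190) (γ₀ : ℝ),
        (∀ (n : ℕ) (gs : ℕ → ℝ), RGEqH n (Node00.datumOfRecord₁₃SepCoPH F 2 θ hP).βfun gs → Step.InInterval γ₀ n gs → ∀ k, k ≤ n →
          ∃ a : LDom 4 → Pt 4 → ℝ, (Node00.datumOfRecord₁₃SepCoPH F 2 θ hP).βfun k (prefixOf gs k) - θ.cβ * beta0OfJs F κ k =
            B12Beta.secondMoment (fun _ _ => limKernel a) μ ν ∧ Nonempty (PolLeavesTFac190H 4 M a c ℓ α₂ q)) ∧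
        CondsL 4 c ℓ ∧ c.R22gen ℓ ∧ q.Valid c.δ₀ ∧ SignsL c α₂ q.B₃ ∧ 0 < γ₀ ∧ γ₀ ≤ θ.γ ∧
        c.ε₁ * remCoeffL 4 M c α₂ q.B₃ ≤ θ.cβ * B12Normalization.stepBal 2 F.L ∧
        ScaleAnchor (Node00.datumOfRecord₁₃SepCoPH F 2 θ hP).βfun (fun k => θ.cβ * beta0OfJs F κ k) ∧
        SurvCont (Node00.datumOfRecord₁₃SepCoPH F 2 θ hP).βfun γ₀) :
    Summit.QuantumFields.YangMills.Theses.BalabanUVNodes.EndpointGivenBR13SepCoPH :=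
  EndpointGivenBR13SepCoPH_of_ownDriftRunChain190K (ownDriftRunChain190K_of_d1AnchoredK_runChain190K hD1 h)

end PairIsSpecialCase

end Summit.QuantumFields.YangMills.Theorems.BalabanUVNodesK2EndOfChain190OwnDrift

end
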